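import Summits.Ventures.QEC.Thresholds.RotatedSurfaceCodeSAWThresholds
import Literature.InformationTheory.QuantumCodes.RotatedSurfaceCodeLossErrorPhaseBoundary
import Literature.InformationTheory.QuantumCodes.RotatedSurfaceCodeErasureHalfX
import Literature.InformationTheory.QuantumCodes.RotatedSurfaceCodeRotation
import Literature.InformationTheory.QuantumCodes.CSSMixedChannelConverse
import Literature.InformationTheory.QuantumCodes.CSSEquivalenceMixedNoise
import HarnessLib

/-!
# The loss–error phase boundary of the rotated surface codes of ODD distance, BOTH sectors (Surface-17/49/97, …)

Venture QEC, `Summits/Ventures/QEC/Thresholds/` (LADDER-QEC rung Q5; qec-type-03 gen 6, item «03.RSCPHASE», second sector). Along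
the odd subfamily `fun i => RotatedSurface.code (2i + 1)` (DEFINITIONALLY type-09's `rscOddCode i`) the `X ↔ Z` exchange of
`RSC(2i+1)` IS `RSC(2i+1)` re-indexed by the quarter turn (type-09's `RotatedSurface.code_swap_eq_reindex`, odd `L` only — for even
`L` no isometry exchanges the colours), so the `H_Z`-sector loss–error family of any decoder family `DX` IS the `H_X`-sector
family of the pulled-back decoders (`CSSEquivalenceMixedNoise.lean`, type-03 M1). This file restates the `H_X`-sector phase
boundary of `RotatedSurfaceLossErrorPhaseBoundary.lean` along the odd subfamily (independently of that file) and transports it: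

* `rscOdd_z_mixed_accuracyThreshold_pos_iff` — `H_X` sector of `RSC(2i+1)`: `0 < p_c(y) ↔ y < 1/2` (`0 ≤ y ≤ 1`);
* ★ `rscOdd_x_mixed_accuracyThreshold_pos_iff` — `H_Z` sector of `RSC(2i+1)`, every minimum-weight-outside-the-losses
  `H_Z`-decoder family: `0 < p_c(y) ↔ y < 1/2`; with the ceiling `rscOdd_x_mixed_accuracyThreshold_le` and
  `rscOdd_lossError_correctableLossRates_eq_bothSectors = Set.Ico 0 (1/2)` twice.

HONEST FRAMING: the `H_Z` sector of EVEN-distance rotated codes is not asserted. UNCONDITIONAL, 0 named facts.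

## References

* [StaceBarrettDoherty2009] T. M. Stace, S. D. Barrett, A. C. Doherty, PRL 102 (2009) 200501, p. 1 (abstract), p. 2–3 and Fig. 2.
* [KestenCMP1980] H. Kesten, Comm. Math. Phys. 74 (1980) 41–59, Thm. 1, Thm. 2 (1.7).
* [BombinMartinDelgado2007Optimal] H. Bombin, M. A. Martin-Delgado, PRA 76 (2007) 012305, §IV (the rotated lattice and its symmetry).
* [DumerKovalevPryadko2015] I. Dumer, A. A. Kovalev, L. P. Pryadko, PRL 115 (2015) 050502, Thm. 2 (the decoder class).
-/

noncomputable section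

namespace Summit.Ventures.QEC.Thresholds

open Filter Topology Matrix
open Literature.InformationTheory.QuantumCodes
open Literature.InformationTheory.QuantumCodes.RotatedSurface
open Literature.Probability.Percolation (Kesten1980_expDecay)

/-! ### The `H_X` sector along the odd subfamily `RSC(2i+1)` -/

/-- **Uniform exponential decay along the odd subfamily**: for `0 ≤ y < 1/2` one `p₀(y) > 0` works for every
minimum-weight-outside-the-losses decoder family of `RSC(2i+1)`. [cite: StaceBarrettDoherty2009, p. 3 and Fig. 2] [cite: KestenCMP1980, Thm. 2 (1.7)] -/
theorem rscOdd_mixedFamily_decaysExponentially {y : ℝ} (hy0 : 0 ≤ y) (hy : y < 1 / 2) :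
    ∃ p₀ : ℝ, 0 < p₀ ∧
      ∀ (D : (i : ℕ) → ErasureDecoder (Fin (2 * i + 1) × Fin (2 * i + 1))
          (Fin (2 * i + 1 + 1) × Fin (2 * i + 1 - 1) → ZMod 2)),
        (∀ i, (D i).IsMinWeightOutside (RotatedSurface.code (2 * i + 1)).HX) →
          ∀ p : ℝ, 0 ≤ p → p ≤ p₀ → DecaysExponentially (fun i p => mixedFailureProb (RotatedSurface.code (2 * i + 1)).HX
            ((RotatedSurface.code (2 * i + 1)).rowSpZ : Set (Fin (2 * i + 1) × Fin (2 * i + 1) → ZMod 2)) (D i) y p) p := by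
  have hy1 : y ≤ 1 := by linarith
  set q : unitInterval := ⟨y, hy0, hy1⟩ with hq
  obtain ⟨c, hc, hdec⟩ := Kesten1980_expDecay q (by simpa [hq] using hy)
  refine ⟨min (rscFlipThreshold c) 1, lt_min (rscFlipThreshold_pos hc) one_pos, fun D hD p hp0 hp => ?_⟩
  have hpt : p ≤ rscFlipThreshold c := hp.trans (min_le_left _ _)
  have hp1 : p ≤ 1 := hp.trans (min_le_right _ _)
  have hK := rscPeierlsConst_pos hc
  set Bc : ℝ := 4 * rscPeierlsConst c * Real.exp (-(c / 4)) + 1 with hB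
  have hB1 : 1 ≤ Bc := by
    have : 0 ≤ 4 * rscPeierlsConst c * Real.exp (-(c / 4)) := by positivity
    linarith
  refine decaysExponentially_of_abs_le_poly_mul_exp (m := 1) (c := c / 4) (B := Bc) (by positivity) fun i => ?_
  have hnn : 0 ≤ mixedFailureProb (RotatedSurface.code (2 * i + 1)).HX
      ((RotatedSurface.code (2 * i + 1)).rowSpZ : Set (Fin (2 * i + 1) × Fin (2 * i + 1) → ZMod 2)) (D i) y p := by
    unfold mixedFailureProb
    exact Finset.sum_nonneg fun Er _ => mul_nonneg (bernoulliWeight_nonneg hy0 hy1 _)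
      (Finset.sum_nonneg fun E _ => bernoulliWeight_nonneg hp0 hp1 _)
  rw [abs_of_nonneg hnn, pow_one]
  rcases Nat.eq_zero_or_pos i with hi | hi
  · subst hi
    have h1 := ToricCode.mixedFailureProb_le_one (RotatedSurface.code (2 * 0 + 1)).HX
      ((RotatedSurface.code (2 * 0 + 1)).rowSpZ : Set (Fin (2 * 0 + 1) × Fin (2 * 0 + 1) → ZMod 2)) (D 0) hy0 hy1 hp0 hp1
    refine h1.trans ?_
    simp [hB1]
  · have h := rsc_mixedFailureProb_le_of_oneArmDecay (L := 2 * i + 1) (by omega) (fun _ hx hxS => rsc_colZero_eq_one (L := 2 * i + 1) (by omega) hx hxS)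
      (hD i) q hc hdec hp0 hpt hp1
    refine h.trans ?_
    have he : Real.exp (-c * (((2 * i + 1 : ℕ) : ℝ) + 1) / 8) = Real.exp (-(c / 4)) * Real.exp (-(c / 4) * i) := by
      rw [← Real.exp_add]; congr 1; push_cast; ring
    rw [he]
    have hpos : 0 ≤ ((i : ℝ) + 1) * Real.exp (-(c / 4) * i) := by positivity
    have h2i : (((2 * i + 1 : ℕ) : ℝ)) ≤ 2 * ((i : ℝ) + 1) := by push_cast; linarith
    have hKe : 0 ≤ rscPeierlsConst c * (Real.exp (-(c / 4)) * Real.exp (-(c / 4) * i)) := by positivity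
    calc 2 * (((2 * i + 1 : ℕ) : ℝ)) * rscPeierlsConst c * (Real.exp (-(c / 4)) * Real.exp (-(c / 4) * i))
        = (((2 * i + 1 : ℕ) : ℝ)) * (2 * (rscPeierlsConst c * (Real.exp (-(c / 4)) * Real.exp (-(c / 4) * i)))) := by ring
      _ ≤ (2 * ((i : ℝ) + 1)) * (2 * (rscPeierlsConst c * (Real.exp (-(c / 4)) * Real.exp (-(c / 4) * i)))) :=
          mul_le_mul_of_nonneg_right h2i (by positivity)
      _ = (4 * rscPeierlsConst c * Real.exp (-(c / 4))) * (((i : ℝ) + 1) * Real.exp (-(c / 4) * i)) := by ring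
      _ ≤ Bc * (((i : ℝ) + 1) * Real.exp (-(c / 4) * i)) := mul_le_mul_of_nonneg_right (by linarith) hpos
      _ = Bc * ((i : ℝ) + 1) * Real.exp (-(c / 4) * i) := by ring

/-- **Positive error threshold below the percolation point, odd subfamily.** [cite: StaceBarrettDoherty2009, p. 3 and Fig. 2] -/
theorem rscOdd_z_mixed_accuracyThreshold_pos
    (D : (i : ℕ) → ErasureDecoder (Fin (2 * i + 1) × Fin (2 * i + 1)) (Fin (2 * i + 1 + 1) × Fin (2 * i + 1 - 1) → ZMod 2))
    (hD : ∀ i, (D i).IsMinWeightOutside (RotatedSurface.code (2 * i + 1)).HX) {y : ℝ} (hy0 : 0 ≤ y) (hy : y < 1 / 2) :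
    0 < accuracyThreshold (fun i p => mixedFailureProb (RotatedSurface.code (2 * i + 1)).HX
      ((RotatedSurface.code (2 * i + 1)).rowSpZ : Set (Fin (2 * i + 1) × Fin (2 * i + 1) → ZMod 2)) (D i) y p) := by
  obtain ⟨p₀, hp₀, h⟩ := rscOdd_mixedFamily_decaysExponentially hy0 hy
  have hlb : IsThresholdLowerBound (fun i p => mixedFailureProb (RotatedSurface.code (2 * i + 1)).HX
      ((RotatedSurface.code (2 * i + 1)).rowSpZ : Set (Fin (2 * i + 1) × Fin (2 * i + 1) → ZMod 2)) (D i) y p) (min p₀ 1) :=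
    fun p hp0 hp => (h D hD p hp0 ((le_of_lt hp).trans (min_le_left _ _))).belowThreshold
  exact lt_of_lt_of_le (lt_min hp₀ one_pos) (le_accuracyThreshold hlb (min_le_right _ _))

/-- **Beyond the curve `y + 2p(1-y) = 1/2`, odd subfamily, ANY decoder**: not below threshold.
[cite: StaceBarrettDoherty2009, p. 2 (the no-cloning boundary)] -/
theorem rscOdd_z_not_belowThreshold_of_gt_curve
    (D : (i : ℕ) → ErasureDecoder (Fin (2 * i + 1) × Fin (2 * i + 1)) (Fin (2 * i + 1 + 1) × Fin (2 * i + 1 - 1) → ZMod 2))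
    {y q : ℝ} (hy0 : 0 ≤ y) (hy1 : y ≤ 1) (hq0 : 0 < q) (hq2 : q ≤ 1 / 2) (hcurve : 1 / 2 < y + (1 - y) * (2 * q)) :
    ¬ BelowThreshold (fun i p => mixedFailureProb (RotatedSurface.code (2 * i + 1)).HX
      ((RotatedSurface.code (2 * i + 1)).rowSpZ : Set (Fin (2 * i + 1) × Fin (2 * i + 1) → ZMod 2)) (D i) y p) q := by
  classical
  intro hbelow
  set y' : ℝ := y + (1 - y) * (2 * q) with hy'
  have hy'le : y' ≤ 1 := by
    have : (1 - y) * (2 * q) ≤ (1 - y) * 1 := mul_le_mul_of_nonneg_left (by linarith) (by linarith)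
    linarith
  set X : ℕ → ℝ := fun L => ErasureDecoder.uncorrectableProb
    {x : Fin (L + 1) × Fin (L + 1) → ZMod 2 | (RotatedSurface.code (L + 1)).HZ *ᵥ x = 0}
    ((RotatedSurface.code (L + 1)).rowSpX : Set (Fin (L + 1) × Fin (L + 1) → ZMod 2)) (1 - y') with hX
  have hX0 : Tendsto X atTop (𝓝 0) := x_lossThreshold_half (1 - y') (by linarith) (by linarith)
  have hφ : StrictMono fun i : ℕ => 2 * i := fun a b h => show 2 * a < 2 * b by omega
  have hX0' : Tendsto (fun i => X (2 * i)) atTop (𝓝 0) := hX0.comp hφ.tendsto_atTop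
  have hle : ∀ i : ℕ, (1 : ℝ) ≤ 2 * mixedFailureProb (RotatedSurface.code (2 * i + 1)).HX
      ((RotatedSurface.code (2 * i + 1)).rowSpZ : Set (Fin (2 * i + 1) × Fin (2 * i + 1) → ZMod 2)) (D i) y q + X (2 * i) :=
    fun i => (RotatedSurface.code (2 * i + 1)).one_le_two_mul_mixed_add_uncorrectable
      (by rw [code_k (by omega)]; exact one_pos) (D i) hy0 hy1 hq0.le hq2
  have hlim : Tendsto (fun i => 2 * mixedFailureProb (RotatedSurface.code (2 * i + 1)).HX
      ((RotatedSurface.code (2 * i + 1)).rowSpZ : Set (Fin (2 * i + 1) × Fin (2 * i + 1) → ZMod 2)) (D i) y q + X (2 * i))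
      atTop (𝓝 (2 * 0 + 0)) := (hbelow.const_mul 2).add hX0'
  have h := le_of_tendsto_of_tendsto' tendsto_const_nhds hlim hle
  linarith

/-- **Beyond loss rate `1/2`, odd subfamily, ANY decoder: `p_c(y) = 0`.** [cite: StaceBarrettDoherty2009, p. 2–3 and Fig. 2] -/
theorem rscOdd_z_mixed_accuracyThreshold_eq_zero
    (D : (i : ℕ) → ErasureDecoder (Fin (2 * i + 1) × Fin (2 * i + 1)) (Fin (2 * i + 1 + 1) × Fin (2 * i + 1 - 1) → ZMod 2))
    {y : ℝ} (hy : 1 / 2 ≤ y) (hy1 : y ≤ 1) :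
    accuracyThreshold (fun i p => mixedFailureProb (RotatedSurface.code (2 * i + 1)).HX
      ((RotatedSurface.code (2 * i + 1)).rowSpZ : Set (Fin (2 * i + 1) × Fin (2 * i + 1) → ZMod 2)) (D i) y p) = 0 := by
  set P : ℕ → ℝ → ℝ := fun i p => mixedFailureProb (RotatedSurface.code (2 * i + 1)).HX
    ((RotatedSurface.code (2 * i + 1)).rowSpZ : Set (Fin (2 * i + 1) × Fin (2 * i + 1) → ZMod 2)) (D i) y p with hP
  refine le_antisymm ?_ (accuracyThreshold_nonneg _)
  by_contra hpos
  push Not at hpos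
  set a := accuracyThreshold P with ha
  set q : ℝ := min (a / 2) (1 / 2) with hq
  have hq0 : 0 < q := lt_min (by linarith) (by norm_num)
  have hqa : q < a := lt_of_le_of_lt (min_le_left _ _) (by linarith)
  have hq2 : q ≤ 1 / 2 := min_le_right _ _
  have hbelow : BelowThreshold P q := belowThreshold_of_lt_accuracyThreshold hq0.le hqa
  have hcurve : 1 / 2 < y + (1 - y) * (2 * q) := by
    rcases eq_or_lt_of_le hy1 with h1 | h1
    · rw [h1]; norm_num
    · have : 0 < (1 - y) * (2 * q) := mul_pos (by linarith) (by linarith)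
      linarith
  exact rscOdd_z_not_belowThreshold_of_gt_curve D (by linarith) hy1 hq0 hq2 hcurve hbelow

/-- **Ceiling, odd subfamily, ANY decoder**: every threshold lower bound `a` at `0 ≤ y < 1/2` has `a ≤ (1 - 2y)/(4(1 - y))`.
[cite: StaceBarrettDoherty2009, p. 2 and Fig. 2] -/
theorem rscOdd_z_mixed_threshold_le
    (D : (i : ℕ) → ErasureDecoder (Fin (2 * i + 1) × Fin (2 * i + 1)) (Fin (2 * i + 1 + 1) × Fin (2 * i + 1 - 1) → ZMod 2))
    {y : ℝ} (hy0 : 0 ≤ y) (hy : y < 1 / 2) {a : ℝ}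
    (ha : IsThresholdLowerBound (fun i p => mixedFailureProb (RotatedSurface.code (2 * i + 1)).HX
      ((RotatedSurface.code (2 * i + 1)).rowSpZ : Set (Fin (2 * i + 1) × Fin (2 * i + 1) → ZMod 2)) (D i) y p) a) :
    a ≤ (1 - 2 * y) / (4 * (1 - y)) := by
  by_contra h
  push Not at h
  set c₀ : ℝ := (1 - 2 * y) / (4 * (1 - y)) with hc₀
  have h1y : 0 < 1 - y := by linarith
  have hc₀0 : 0 ≤ c₀ := div_nonneg (by linarith) (by linarith)
  have hc₀y : y + (1 - y) * (2 * c₀) = 1 / 2 := by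
    rw [hc₀]; field_simp; ring
  set p₁ : ℝ := min ((a + c₀) / 2) (1 / 2) with hp₁
  have hp₁c : c₀ < p₁ := by
    refine lt_min (by linarith) ?_
    have : c₀ ≤ 1 / 4 := by
      rw [hc₀, div_le_iff₀ (by linarith)]; linarith
    linarith
  have hp₁a : p₁ < a := by
    rcases le_total ((a + c₀) / 2) (1 / 2) with hle | hle
    · rw [hp₁, min_eq_left hle]; linarith
    · rw [hp₁, min_eq_right hle]; linarith
  have hp₁0 : 0 < p₁ := lt_of_le_of_lt hc₀0 hp₁c
  have hp₁2 : p₁ ≤ 1 / 2 := min_le_right _ _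
  have hcurve : 1 / 2 < y + (1 - y) * (2 * p₁) := by
    have : (1 - y) * (2 * c₀) < (1 - y) * (2 * p₁) := mul_lt_mul_of_pos_left (by linarith) h1y
    linarith
  exact rscOdd_z_not_belowThreshold_of_gt_curve D hy0 (by linarith) hp₁0 hp₁2 hcurve (ha p₁ hp₁0.le hp₁a)

/-- ★ **Phase boundary, `H_X` sector, odd distances**: `0 < p_c(y) ↔ y < 1/2` for every minimum-weight-outside-the-losses decoder
family of `RSC(2i+1)`. [cite: StaceBarrettDoherty2009, p. 1 (abstract) and Fig. 2] [cite: KestenCMP1980, Thm. 1] -/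
theorem rscOdd_z_mixed_accuracyThreshold_pos_iff
    (D : (i : ℕ) → ErasureDecoder (Fin (2 * i + 1) × Fin (2 * i + 1)) (Fin (2 * i + 1 + 1) × Fin (2 * i + 1 - 1) → ZMod 2))
    (hD : ∀ i, (D i).IsMinWeightOutside (RotatedSurface.code (2 * i + 1)).HX) {y : ℝ} (hy0 : 0 ≤ y) (hy1 : y ≤ 1) :
    0 < accuracyThreshold (fun i p => mixedFailureProb (RotatedSurface.code (2 * i + 1)).HX
      ((RotatedSurface.code (2 * i + 1)).rowSpZ : Set (Fin (2 * i + 1) × Fin (2 * i + 1) → ZMod 2)) (D i) y p) ↔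
      y < 1 / 2 := by
  constructor
  · intro h
    by_contra hge
    push Not at hge
    have := rscOdd_z_mixed_accuracyThreshold_eq_zero D hge hy1
    linarith
  · exact rscOdd_z_mixed_accuracyThreshold_pos D hD hy0

/-! ### The `H_Z` sector of `RSC(2i+1)` by the quarter turn -/

/-- **The `H_Z`-sector loss–error family of `RSC(2i+1)` IS an `H_X`-sector family** of the decoders pulled back along the quarter
turn (`code_swap_eq_reindex`, odd `L`; transport of `mixedFailureProb`). [cite: BombinMartinDelgado2007Optimal, §IV (the symmetry of the rotated lattice)] -/
theorem rscOdd_xMixedFamily_eq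
    (DX : (i : ℕ) → ErasureDecoder (Fin (2 * i + 1) × Fin (2 * i + 1)) (Fin (2 * i + 1 - 1) × Fin (2 * i + 1 + 1) → ZMod 2))
    (y : ℝ) :
    (fun i p => mixedFailureProb (RotatedSurface.code (2 * i + 1)).HZ
        ((RotatedSurface.code (2 * i + 1)).rowSpX : Set (Fin (2 * i + 1) × Fin (2 * i + 1) → ZMod 2)) (DX i) y p) =
      fun i p => mixedFailureProb (RotatedSurface.code (2 * i + 1)).HX
        ((RotatedSurface.code (2 * i + 1)).rowSpZ : Set (Fin (2 * i + 1) × Fin (2 * i + 1) → ZMod 2))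
        (CSSCode.reindexErasureDecoder (qturn (2 * i + 1 - 1) (2 * i + 1 + 1)).symm.symm
          (qturn (2 * i + 1) (2 * i + 1)).symm.symm (DX i)) y p := by
  funext i p
  have hodd : Odd (2 * i + 1) := odd_two_mul_add_one i
  have h : mixedFailureProb (RotatedSurface.code (2 * i + 1)).HZ
      ((RotatedSurface.code (2 * i + 1)).rowSpX : Set (Fin (2 * i + 1) × Fin (2 * i + 1) → ZMod 2)) (DX i) y p =
      mixedFailureProb (RotatedSurface.code (2 * i + 1)).swap.HX
        ((RotatedSurface.code (2 * i + 1)).swap.rowSpZ : Set (Fin (2 * i + 1) × Fin (2 * i + 1) → ZMod 2)) (DX i) y p := rfl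
  rw [h, code_swap_eq_reindex hodd, CSSCode.mixedFailureProb_reindex_symm]

/-- The pulled-back decoders of minimum-weight-outside-the-losses `H_Z`-decoders are minimum-weight-outside-the-losses
`H_X`-decoders. [cite: DumerKovalevPryadko2015, Thm 2 (the decoder class)] -/
theorem rscOdd_xPullback_isMinWeightOutside
    (DX : (i : ℕ) → ErasureDecoder (Fin (2 * i + 1) × Fin (2 * i + 1)) (Fin (2 * i + 1 - 1) × Fin (2 * i + 1 + 1) → ZMod 2))
    (hDX : ∀ i, (DX i).IsMinWeightOutside (RotatedSurface.code (2 * i + 1)).HZ) (i : ℕ) :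
    (CSSCode.reindexErasureDecoder (qturn (2 * i + 1 - 1) (2 * i + 1 + 1)).symm.symm
      (qturn (2 * i + 1) (2 * i + 1)).symm.symm (DX i)).IsMinWeightOutside (RotatedSurface.code (2 * i + 1)).HX :=
  CSSCode.isMinWeightOutside_reindexErasureDecoder_symm (RotatedSurface.code (2 * i + 1))
    (qturn (2 * i + 1 - 1) (2 * i + 1 + 1)).symm (qturn (2 * i + 1 + 1) (2 * i + 1 - 1)).symm
    (qturn (2 * i + 1) (2 * i + 1)).symm (D' := DX i)
    (by rw [← code_swap_eq_reindex (odd_two_mul_add_one i)]; exact hDX i)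

/-- ★ **Phase boundary, `H_Z` sector, odd distances** (Surface-17/49/97, …): for `0 ≤ y ≤ 1` and every family of
minimum-weight-outside-the-losses `H_Z`-decoders of `RSC(2i+1)`, the error accuracy threshold at loss rate `y` is positive iff
`y < 1/2`. [cite: StaceBarrettDoherty2009, p. 1 (abstract) and Fig. 2] [cite: KestenCMP1980, Thm. 1] -/
theorem rscOdd_x_mixed_accuracyThreshold_pos_iff
    (DX : (i : ℕ) → ErasureDecoder (Fin (2 * i + 1) × Fin (2 * i + 1)) (Fin (2 * i + 1 - 1) × Fin (2 * i + 1 + 1) → ZMod 2))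
    (hDX : ∀ i, (DX i).IsMinWeightOutside (RotatedSurface.code (2 * i + 1)).HZ) {y : ℝ} (hy0 : 0 ≤ y) (hy1 : y ≤ 1) :
    0 < accuracyThreshold (fun i p => mixedFailureProb (RotatedSurface.code (2 * i + 1)).HZ
      ((RotatedSurface.code (2 * i + 1)).rowSpX : Set (Fin (2 * i + 1) × Fin (2 * i + 1) → ZMod 2)) (DX i) y p) ↔
      y < 1 / 2 := by
  rw [rscOdd_xMixedFamily_eq]
  exact rscOdd_z_mixed_accuracyThreshold_pos_iff _ (rscOdd_xPullback_isMinWeightOutside DX hDX) hy0 hy1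

/-- **`H_Z` sector, odd distances, beyond `1/2`**: `p_c(y) = 0` for `1/2 ≤ y ≤ 1` and EVERY erasure-aware `H_Z`-decoder family.
[cite: StaceBarrettDoherty2009, p. 2–3 and Fig. 2] -/
theorem rscOdd_x_mixed_accuracyThreshold_eq_zero
    (DX : (i : ℕ) → ErasureDecoder (Fin (2 * i + 1) × Fin (2 * i + 1)) (Fin (2 * i + 1 - 1) × Fin (2 * i + 1 + 1) → ZMod 2))
    {y : ℝ} (hy : 1 / 2 ≤ y) (hy1 : y ≤ 1) :
    accuracyThreshold (fun i p => mixedFailureProb (RotatedSurface.code (2 * i + 1)).HZ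
      ((RotatedSurface.code (2 * i + 1)).rowSpX : Set (Fin (2 * i + 1) × Fin (2 * i + 1) → ZMod 2)) (DX i) y p) = 0 := by
  rw [rscOdd_xMixedFamily_eq]
  exact rscOdd_z_mixed_accuracyThreshold_eq_zero _ hy hy1

/-- **`H_Z` sector, odd distances, the ceiling**: `p_c(y) ≤ (1 - 2y)/(4(1 - y))` for `0 ≤ y < 1/2`, every erasure-aware
`H_Z`-decoder family. [cite: StaceBarrettDoherty2009, p. 2 and Fig. 2] -/
theorem rscOdd_x_mixed_accuracyThreshold_le
    (DX : (i : ℕ) → ErasureDecoder (Fin (2 * i + 1) × Fin (2 * i + 1)) (Fin (2 * i + 1 - 1) × Fin (2 * i + 1 + 1) → ZMod 2))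
    {y : ℝ} (hy0 : 0 ≤ y) (hy : y < 1 / 2) :
    accuracyThreshold (fun i p => mixedFailureProb (RotatedSurface.code (2 * i + 1)).HZ
      ((RotatedSurface.code (2 * i + 1)).rowSpX : Set (Fin (2 * i + 1) × Fin (2 * i + 1) → ZMod 2)) (DX i) y p) ≤
      (1 - 2 * y) / (4 * (1 - y)) := by
  rw [rscOdd_xMixedFamily_eq]
  exact rscOdd_z_mixed_threshold_le _ hy0 hy (isThresholdLowerBound_accuracyThreshold _)

/-- ★ **Both sectors of the odd-distance rotated surface codes**: the loss rates with a positive error threshold are EXACTLY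
`[0, 1/2)` in the `H_X` sector AND in the `H_Z` sector (any minimum-weight-outside-the-losses decoder families `D`, `DX`).
[cite: StaceBarrettDoherty2009, p. 1 (abstract: the maximum tolerable loss rate is 50%) and Fig. 2] [cite: KestenCMP1980, Thm. 1] -/
theorem rscOdd_lossError_correctableLossRates_eq_bothSectors
    (D : (i : ℕ) → ErasureDecoder (Fin (2 * i + 1) × Fin (2 * i + 1)) (Fin (2 * i + 1 + 1) × Fin (2 * i + 1 - 1) → ZMod 2))
    (hD : ∀ i, (D i).IsMinWeightOutside (RotatedSurface.code (2 * i + 1)).HX)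
    (DX : (i : ℕ) → ErasureDecoder (Fin (2 * i + 1) × Fin (2 * i + 1)) (Fin (2 * i + 1 - 1) × Fin (2 * i + 1 + 1) → ZMod 2))
    (hDX : ∀ i, (DX i).IsMinWeightOutside (RotatedSurface.code (2 * i + 1)).HZ) :
    {y : ℝ | 0 ≤ y ∧ y ≤ 1 ∧ 0 < accuracyThreshold (fun i p => mixedFailureProb (RotatedSurface.code (2 * i + 1)).HX
        ((RotatedSurface.code (2 * i + 1)).rowSpZ : Set (Fin (2 * i + 1) × Fin (2 * i + 1) → ZMod 2)) (D i) y p)} =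
      Set.Ico 0 (1 / 2) ∧
    {y : ℝ | 0 ≤ y ∧ y ≤ 1 ∧ 0 < accuracyThreshold (fun i p => mixedFailureProb (RotatedSurface.code (2 * i + 1)).HZ
        ((RotatedSurface.code (2 * i + 1)).rowSpX : Set (Fin (2 * i + 1) × Fin (2 * i + 1) → ZMod 2)) (DX i) y p)} =
      Set.Ico 0 (1 / 2) := by
  constructor
  · ext y
    simp only [Set.mem_setOf_eq, Set.mem_Ico]
    constructor
    · rintro ⟨hy0, hy1, hpos⟩
      exact ⟨hy0, (rscOdd_z_mixed_accuracyThreshold_pos_iff D hD hy0 hy1).1 hpos⟩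
    · rintro ⟨hy0, hy⟩
      exact ⟨hy0, by linarith, (rscOdd_z_mixed_accuracyThreshold_pos_iff D hD hy0 (by linarith)).2 hy⟩
  · ext y
    simp only [Set.mem_setOf_eq, Set.mem_Ico]
    constructor
    · rintro ⟨hy0, hy1, hpos⟩
      exact ⟨hy0, (rscOdd_x_mixed_accuracyThreshold_pos_iff DX hDX hy0 hy1).1 hpos⟩
    · rintro ⟨hy0, hy⟩
      exact ⟨hy0, by linarith, (rscOdd_x_mixed_accuracyThreshold_pos_iff DX hDX hy0 (by linarith)).2 hy⟩

/-- **Non-vacuity, `H_Z` sector**: with the canonical minimum-weight-outside-the-losses `H_Z`-decoders of `RSC(2i+1)` the error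
threshold is POSITIVE at loss rate `1/4` and ZERO at loss rate `1/2`. [cite: DumerKovalevPryadko2015, p. 3 (exhaustive search decoder)] -/
theorem rscOdd_x_lossError_nonvacuous :
    0 < accuracyThreshold (fun i p => mixedFailureProb (RotatedSurface.code (2 * i + 1)).HZ
        ((RotatedSurface.code (2 * i + 1)).rowSpX : Set (Fin (2 * i + 1) × Fin (2 * i + 1) → ZMod 2))
        (ErasureDecoder.minWeightOutside (RotatedSurface.code (2 * i + 1)).HZ) (1 / 4) p) ∧
      accuracyThreshold (fun i p => mixedFailureProb (RotatedSurface.code (2 * i + 1)).HZ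
        ((RotatedSurface.code (2 * i + 1)).rowSpX : Set (Fin (2 * i + 1) × Fin (2 * i + 1) → ZMod 2))
        (ErasureDecoder.minWeightOutside (RotatedSurface.code (2 * i + 1)).HZ) (1 / 2) p) = 0 :=
  ⟨(rscOdd_x_mixed_accuracyThreshold_pos_iff (fun i => ErasureDecoder.minWeightOutside (RotatedSurface.code (2 * i + 1)).HZ)
      (fun i => ErasureDecoder.minWeightOutside_isMinWeightOutside _) (by norm_num) (by norm_num)).2 (by norm_num),
    rscOdd_x_mixed_accuracyThreshold_eq_zero _ (by norm_num) (by norm_num)⟩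

end Summit.Ventures.QEC.Thresholds
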